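import Literature.AlgebraicGeometry.HodgeTheory.HomComplexSigmaConj
import Literature.AlgebraicGeometry.HodgeTheory.SigmaArgument
import HarnessLib

/-!
# `σ_q` of a strictly perfect complex is invariant under QUASI-isomorphisms (model independence; SIGMA-INVARIANCE step (I6))

PROMOTED LITERATURE COPY (librarian protocol (b); DEFREQ-CoherentISemiregular, cell pub-hsemireg) of the generic, conjecture-free
`Summits/Ventures/HSemireg/HomComplexSigmaQuasiIso.lean` — namespace now `Literature.AlgebraicGeometry.HodgeTheory`, names kept; cell words (seats, ventures) = provenance.

Cell `pub-hsemireg`, general-structure seat gs-g4 (gen 18); item (I6-qis) of general-structure/SIGMA-INVARIANCE-PLAN-gs-g4.md,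
sequel to t-7's `HomComplexSigmaConj.lean` ((I5-iso): invariance under ISOMORPHISMS of complexes, `sigmaC_conj` /
`isISemiregularC_iff_of_iso`).  HONEST FRAMING: kernel plumbing on real carriers — NOT a door, NOT a named fact, NOT a
«K2 result»; nothing here says HC, HC_CM or HC_AV is proved.

The predicate «`K•` is `q`-semiregular» (`HomComplex.sigmaC`, `IsSemiregularC`, `IsISemiregularC` of `HomComplexSigma.lean`)
is attached to a strictly perfect MODEL `K•` (a bounded complex of finite locally free `𝒪_X`-modules), whereas [BF03] / [Pridham]
state semiregularity for the object of `D^b(X)`; two strictly perfect resolutions of one object are in general only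
QUASI-isomorphic.  This file proves that `σ_q` and the predicates do not depend on the model within a quasi-isomorphism class
of strictly perfect complexes (in a common amplitude window `[a, b]`):

* **`sigmaC_eq_of_quasiIso`** — for a quasi-isomorphism `f : K₁• ⟶ K₂•` of strictly perfect complexes and classes
  `x ∈ Ext²(K₁•, K₁•)`, `x' ∈ Ext²(K₂•, K₂•)` intertwined by `Q f` (`x · Q f = Q f · x'`): `σ_q(K₁•)(x) = σ_q(K₂•)(x')`;
* **`isISemiregularC_iff_of_quasiIso`**, **`isSemiregularC_iff_of_quasiIso`** — `I`-semiregularity (any set `I` of form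
  degrees) and `q`-semiregularity are transported along `f` (conjugation by the isomorphism `Q f` of `D(X)` is a bijection
  `Ext²(K₁•, K₁•) ≃ Ext²(K₂•, K₂•)` intertwining the `σ_q`);
* **`isISemiregularC_iff_of_roof`** — the same along a roof `K₁• ⟵ K₃• ⟶ K₂•` of quasi-isomorphisms of strictly perfect
  complexes (the shape of a morphism of `D(X)` between two strictly perfect resolutions dominated by a third).
t-7's `sigmaC_conj` / `isISemiregularC_iff_of_iso` are the case `f = φ.hom` of an isomorphism `φ`.

WHY NO CONTRAVARIANT QUASI-ISOMORPHISM LEMMA IS NEEDED (the plan's (I7) «`𝓗om•(f, L•)` is a quasi-iso» is NOT used): writing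
`σ(K)(x) = Q(unit_K) ≫ Φ_K(x · ι · At(K)^q) ≫ Q(Tr_K)⟦q+2⟧'` and `z := (Q f)⁻¹ · (x · ι · At(K₁)^q)`, the only morphism ever
inverted is `Q f` itself:
(s1) `Φ_{K₁}(x · ι · At^q) = Q(𝓗om•(K₁, f)) ≫ Φ_{K₁}(z)` (`shiftedHomMap_mk₀_comp`, seat gs-g4);
(s2) `unit_{K₁} ≫ 𝓗om•(K₁, f) = unit_{K₂} ≫ 𝓗om•(f, K₂)` (`unit_comp_map_eq_unit_comp_premap`, seat t-7);
(s3) `Q(𝓗om•(f, K₂)) ≫ Φ_{K₁}(z) = Φ_{K₂}(z) ≫ Q(𝓗om•(f, K₁ ⊗ Ω^q))⟦q+2⟧'` (`shiftedHomMap_comp_shift_map` at t-7's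
`premapNatTrans`, which commutes with shifts by Mathlib `BifunctorShift`; seats gs-g4 / t-7);
(s4) `𝓗om•(f, K₁ ⊗ Ω^q) ≫ Tr_{K₁} = 𝓗om•(K₂, f ⊗ 1) ≫ Tr_{K₂}` (t-7's `supertraceH_dinatural`, from `supertrace_dinatural`);
(s5) `Φ_{K₂}(z) ≫ Q(𝓗om•(K₂, f ⊗ 1))⟦q+2⟧' = Φ_{K₂}(z · Q(f ⊗ 1)) = Φ_{K₂}(x' · ι · At(K₂)^q)` (`shiftedHomMap_comp_mk₀` and
`extMulAtiyahPower_naturality`: `(x · ι · At(K₁)^q) · Q(f ⊗ 1) = Q f · (x' · ι · At(K₂)^q)`, seat gs-g4).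
Module-level ancestor: `sigmaHigher_conj` / `isISemiregular_of_iso` (`HigherSigmaOfIso.lean`).  No definitions in this file.

## References
* R.-O. Buchweitz, H. Flenner, *A semiregularity map for modules and applications to deformations*, Compositio Math. 137
  (2003), Def. 4.1, §4–§5. [BuchweitzFlenner2003]
* Mathlib: `DerivedCategory.isIso_Q_map_iff_quasiIso`, `CategoryTheory.Localization.liftNatTrans`, `BifunctorShift`.
-/

noncomputable section

open CategoryTheory CategoryTheory.Limits CategoryTheory.Category AlgebraicGeometry

namespace Literature.AlgebraicGeometry.HodgeTheory

open Literature.AlgebraicGeometry.Modules Literature.AlgebraicGeometry.Motives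
open Literature.AlgebraicGeometry.HodgeTheory
open DerivedCategory

namespace HomComplex

section QuasiIso

universe w₁ u₁

variable {S : Type u₁} [CommRing S] (X : Over (Spec (CommRingCat.of S))) [HasDerivedCategory.{w₁} X.left.Modules]
  {K₁ K₂ : CochainComplex X.left.Modules ℤ} (a b : ℤ)
  [K₁.IsStrictlyGE a] [K₁.IsStrictlyLE b] [K₂.IsStrictlyGE a] [K₂.IsStrictlyLE b]
  (hK₁ : ∀ p, IsFiniteLocallyFree (K₁.X p)) (hK₂ : ∀ p, IsFiniteLocallyFree (K₂.X p)) (f : K₁ ⟶ K₂) (q : ℕ)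

/-- Congruence for the outer degree-`0` factor of a `ShiftedHom` composite: to compare `P₁ · t₁` with `P₂ · t₂` in any
target degree `c = 0 + n` it suffices to compare `P₁ ≫ t₁⟦n⟧'` with `P₂ ≫ t₂⟦n⟧'` (the shape of the last factor
`Q(Tr•)` of `sigmaC`, whose target degree `((q + 2 : ℕ) : ℤ)` is a cast of `(q : ℤ) + 2`). [cite: BuchweitzFlenner2003, Def. 4.1] -/
theorem shiftedHom_comp_mk₀_congr {D : Type*} [Category D] [HasShift D ℤ] {A B₁ B₂ Z : D} {n c : ℤ}
    (P₁ : ShiftedHom A B₁ n) (P₂ : ShiftedHom A B₂ n) (t₁ : B₁ ⟶ Z) (t₂ : B₂ ⟶ Z) (h : (0 : ℤ) + n = c)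
    (e : P₁ ≫ (shiftFunctor D n).map t₁ = P₂ ≫ (shiftFunctor D n).map t₂) :
    P₁.comp (ShiftedHom.mk₀ (0 : ℤ) rfl t₁) h = P₂.comp (ShiftedHom.mk₀ (0 : ℤ) rfl t₂) h := by
  simp only [ShiftedHom.comp, ShiftedHom.mk₀, Functor.map_comp, assoc]
  rw [reassoc_of% e]

set_option backward.isDefEq.respectTransparency false in
/-- **`σ_q` is invariant under quasi-isomorphisms of strictly perfect models.**  For `K₁•, K₂• ∈ [a, b]` termwise finite
locally free, a quasi-isomorphism `f : K₁• ⟶ K₂•` and classes `x ∈ Ext²(K₁•, K₁•)`, `x' ∈ Ext²(K₂•, K₂•)` with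
`x · Q f = Q f · x'` (i.e. `x'` is the transport of `x` along the isomorphism `Q f` of `D(X)`):
`σ_q(K₁•)(x) = σ_q(K₂•)(x')`. [cite: BuchweitzFlenner2003, Def. 4.1] -/
theorem sigmaC_eq_of_quasiIso [QuasiIso f] (x : ShiftedHom (Q.obj K₁) (Q.obj K₁) (2 : ℤ))
    (x' : ShiftedHom (Q.obj K₂) (Q.obj K₂) (2 : ℤ))
    (h : x.comp (ShiftedHom.mk₀ (0 : ℤ) rfl (Q.map f)) (zero_add 2) =
      (ShiftedHom.mk₀ (0 : ℤ) rfl (Q.map f)).comp x' (add_zero 2)) :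
    sigmaC X K₁ a b hK₁ q x = sigmaC X K₂ a b hK₂ q x' := by
  haveI : IsIso (Q.map f) := (isIso_Q_map_iff_quasiIso (φ := f)).2 inferInstance
  -- the transported argument `z := (Q f)⁻¹ · (x · ι · At(K₁)^q) : Q K₂ ⟶ Q (K₁ ⊗ Ω^q)⟦q+2⟧`
  set z : ShiftedHom (Q.obj K₂) (Q.obj (twistHodgeComplex X q K₁)) ((q : ℤ) + 2) :=
    (ShiftedHom.mk₀ (0 : ℤ) rfl (inv (Q.map f))).comp (extMulAtiyahPower X K₁ q x) (add_zero _) with hzdef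
  have hz : (ShiftedHom.mk₀ (0 : ℤ) rfl (Q.map f)).comp z (add_zero _) = extMulAtiyahPower X K₁ q x := by
    rw [hzdef, ShiftedHom.mk₀_comp_mk₀_assoc, IsIso.hom_inv_id, ShiftedHom.mk₀_id_comp]
  have hz' : z.comp (ShiftedHom.mk₀ (0 : ℤ) rfl (Q.map (twistHodgeComplexMap X q f))) (zero_add _) =
      extMulAtiyahPower X K₂ q x' := by
    rw [hzdef, twistHodgeComplexMap_eq, shiftedHom_mk₀_comp_comp, extMulAtiyahPower_naturality q f x x' h,
      ShiftedHom.mk₀_comp_mk₀_assoc, IsIso.inv_hom_id, ShiftedHom.mk₀_id_comp]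
  rw [sigmaC, sigmaC]
  refine shiftedHom_comp_mk₀_congr _ _ _ _ _ ?_
  rw [ShiftedHom.mk₀_comp, ShiftedHom.mk₀_comp, phiMulAtiyahPower, phiMulAtiyahPower, assoc, assoc]
  -- (s1) `Φ_{K₁}(x·ι·At^q) = Q(𝓗om•(K₁, f)) ≫ Φ_{K₁}(z)`
  have hs1 : shiftedHomMap (homFunctor X.left K₁) (homFunctor_isInvertedBy X K₁ a b hK₁) (extMulAtiyahPower X K₁ q x) =
      Q.map ((homFunctor X.left K₁).map f) ≫
        shiftedHomMap (homFunctor X.left K₁) (homFunctor_isInvertedBy X K₁ a b hK₁) z := by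
    rw [← hz, shiftedHomMap_mk₀_comp, ShiftedHom.mk₀_comp]
  -- (s2) the unit exchange, after `Q`
  have hs2 : unitQ X K₁ a b ≫ Q.map ((homFunctor X.left K₁).map f) =
      unitQ X K₂ a b ≫ Q.map ((premapNatTrans X.left f).app K₂) := by
    have e := congrArg Q.map (unit_comp_map_eq_unit_comp_premap X.left K₁ a b K₂ f)
    simp only [Functor.map_comp] at e
    exact e
  -- (s3) `𝓗om•(f, –)` past `Φ` (t-7's `premapNatTrans`, CommShift from Mathlib `BifunctorShift`)
  have hs3 := shiftedHomMap_comp_shift_map (homFunctor_isInvertedBy X K₂ a b hK₂) (homFunctor_isInvertedBy X K₁ a b hK₁)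
    (premapNatTrans X.left f) z
  -- (s4) the supertrace, after `Q` and `⟦q+2⟧` (t-7's `supertraceH_dinatural`)
  have hs4 := congrArg (fun φ' => (Q.map φ')⟦(q : ℤ) + 2⟧') (supertraceH_dinatural X hK₁ hK₂ q f).symm
  simp only [Functor.map_comp] at hs4
  -- (s5) absorb `𝓗om•(K₂, f ⊗ 1)` into `Φ_{K₂}`
  have hs5 : shiftedHomMap (homFunctor X.left K₂) (homFunctor_isInvertedBy X K₂ a b hK₂) z ≫
      (Q.map ((homFunctor X.left K₂).map (twistHodgeComplexMap X q f)))⟦(q : ℤ) + 2⟧' =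
      shiftedHomMap (homFunctor X.left K₂) (homFunctor_isInvertedBy X K₂ a b hK₂) (extMulAtiyahPower X K₂ q x') := by
    rw [← hz', shiftedHomMap_comp_mk₀, ShiftedHom.comp_mk₀]
  rw [hs1, assoc, reassoc_of% hs2, ← reassoc_of% hs3, hs4, reassoc_of% hs5]

/-- **`I`-semiregularity is invariant under quasi-isomorphisms of strictly perfect models**: conjugation by the
isomorphism `Q f` of `D(X)` is a bijection `Ext²(K₁•, K₁•) ≃ Ext²(K₂•, K₂•)` intertwining `(σ_q)_{q ∈ I}`
(`sigmaC_eq_of_quasiIso`), so joint injectivity is transported. [cite: BuchweitzFlenner2003, §5 (I-semiregular)] -/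
theorem isISemiregularC_iff_of_quasiIso [QuasiIso f] (I : Set ℕ) :
    IsISemiregularC X K₁ a b hK₁ I ↔ IsISemiregularC X K₂ a b hK₂ I := by
  haveI : IsIso (Q.map f) := (isIso_Q_map_iff_quasiIso (φ := f)).2 inferInstance
  -- conjugation by `Q f` and its inverse
  let c : ShiftedHom (Q.obj K₁) (Q.obj K₁) (2 : ℤ) → ShiftedHom (Q.obj K₂) (Q.obj K₂) (2 : ℤ) :=
    fun x => inv (Q.map f) ≫ x ≫ (Q.map f)⟦(2 : ℤ)⟧'
  let c' : ShiftedHom (Q.obj K₂) (Q.obj K₂) (2 : ℤ) → ShiftedHom (Q.obj K₁) (Q.obj K₁) (2 : ℤ) :=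
    fun x' => Q.map f ≫ x' ≫ (inv (Q.map f))⟦(2 : ℤ)⟧'
  have hc : Function.Bijective c := by
    refine Function.bijective_iff_has_inverse.2 ⟨c', fun x => ?_, fun x' => ?_⟩
    · change Q.map f ≫ (inv (Q.map f) ≫ x ≫ (Q.map f)⟦(2 : ℤ)⟧') ≫ (inv (Q.map f))⟦(2 : ℤ)⟧' = x
      simp only [assoc, IsIso.hom_inv_id_assoc, ← Functor.map_comp, IsIso.hom_inv_id, CategoryTheory.Functor.map_id, comp_id]
    · change inv (Q.map f) ≫ (Q.map f ≫ x' ≫ (inv (Q.map f))⟦(2 : ℤ)⟧') ≫ (Q.map f)⟦(2 : ℤ)⟧' = x'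
      simp only [assoc, IsIso.inv_hom_id_assoc, ← Functor.map_comp, IsIso.inv_hom_id, CategoryTheory.Functor.map_id, comp_id]
  have hσ : (fun (x : ShiftedHom (Q.obj K₁) (Q.obj K₁) (2 : ℤ)) (q : I) => sigmaC X K₁ a b hK₁ q x) =
      (fun (x' : ShiftedHom (Q.obj K₂) (Q.obj K₂) (2 : ℤ)) (q : I) => sigmaC X K₂ a b hK₂ q x') ∘ c := by
    funext x
    funext q'
    refine sigmaC_eq_of_quasiIso X a b hK₁ hK₂ f q' x (c x) ?_
    rw [ShiftedHom.comp_mk₀, ShiftedHom.mk₀_comp]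
    change _ = Q.map f ≫ inv (Q.map f) ≫ x ≫ (Q.map f)⟦(2 : ℤ)⟧'
    rw [IsIso.hom_inv_id_assoc]
  rw [IsISemiregularC, IsISemiregularC, hσ]
  exact Function.Injective.of_comp_iff' _ hc

/-- **`q`-semiregularity is invariant under quasi-isomorphisms of strictly perfect models.**
[cite: BuchweitzFlenner2003, Def. 4.1] -/
theorem isSemiregularC_iff_of_quasiIso [QuasiIso f] :
    IsSemiregularC X K₁ a b hK₁ q ↔ IsSemiregularC X K₂ a b hK₂ q := by
  rw [isSemiregularC_iff_isISemiregularC_singleton, isSemiregularC_iff_isISemiregularC_singleton]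
  exact isISemiregularC_iff_of_quasiIso X a b hK₁ hK₂ f {q}

omit f in
/-- **Model independence along a roof**: if two strictly perfect complexes `K₁•`, `K₂•` (in `[a, b]`) receive
quasi-isomorphisms from a third one `K₃•` (e.g. two strictly perfect resolutions of one object of `D(X)` dominated by a
common one), then `K₁•` is `I`-semiregular iff `K₂•` is. [cite: BuchweitzFlenner2003, §5 (I-semiregular)] -/
theorem isISemiregularC_iff_of_roof {K₃ : CochainComplex X.left.Modules ℤ} [K₃.IsStrictlyGE a] [K₃.IsStrictlyLE b]
    (hK₃ : ∀ p, IsFiniteLocallyFree (K₃.X p)) (g₁ : K₃ ⟶ K₁) (g₂ : K₃ ⟶ K₂) [QuasiIso g₁] [QuasiIso g₂]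
    (I : Set ℕ) : IsISemiregularC X K₁ a b hK₁ I ↔ IsISemiregularC X K₂ a b hK₂ I :=
  (isISemiregularC_iff_of_quasiIso X a b hK₃ hK₁ g₁ I).symm.trans (isISemiregularC_iff_of_quasiIso X a b hK₃ hK₂ g₂ I)

end QuasiIso

end HomComplex

end Literature.AlgebraicGeometry.HodgeTheory

end
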